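import Summits.Ventures.Crystal3D.Theorems.StickyWulffConstantNoReconstructionGainGrainFrameLocal
import HarnessLib

/-!
# Frame-registered films with interstitial contacts above: the per-ball reduction (multi-frame films)

HONEST FRAMING. Part of the venture `Summits/Ventures/Crystal3D` (cell `crystal3d-full`), helper
`--supports` the crux `NoReconstructionGain` (stmt-Ventures-19144, route
`route-Ventures-StickyWulffConstant`), line `adhesion` (wulff-p1 g12).  A one-hypothesis
generalisation of `perBall_frameFilm_le` (`…GrainFrameLocal`, g11) that opens class (iii) beyond a
single moved fcc lattice: the frame `U` may now be chosen PER BALL, and a film contact of `q` need not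
be registered in `q`'s frame provided it is interstitial (outside all `30°`-caps of `U`) and STRICTLY
ABOVE `q` — such a contact costs nothing in the frame account of `q` (the account only charges
interstitial film contacts below or level with `q`).

Use (next file, `…MultiFrameFilm`): an hcp-type (or any Barlow-type) misoriented grain whose basal
plane is tilted by less than `54.7°` from the cut: give each film ball the moved fcc bond star that
contains its six in-plane and three DOWN bonds; its three UP bonds are then interstitial (`33.6°` from
the nearest frame direction) and strictly above, and the cap budget of that star (`stub_frameCapBudget`,
`…GrainFrameBudgetThree`) makes the per-ball account `≤ 0`.

* `perBall_frameFilm_le_of_above` — the per-ball summand of the frame account of `q` (frame `U`,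
  `c = √3/2`) plus its rim summand is `≤ 0`, for `q` with at most three substrate contacts, film above
  the cut, substrate below, every film contact of `q` registered in `U` or interstitial-above.

WHAT THIS IS NOT: the summation over the film (the transfer terms of different frames must still
cancel — next file); rung F-C1 not moved.
-/

noncomputable section

namespace Summit.Ventures.Crystal3D.Theorems

open Summit.Ventures.Crystal3D Finset
open Literature.MathematicalPhysics.StatisticalMechanics (fccStacking orderedContacts contactDeficiency)
open scoped InnerProductSpace

/-- **Per-ball reduction to the cap budget, film contacts registered or interstitial-above.**  As
`perBall_frameFilm_le` (`…GrainFrameLocal`), but a film contact `x` of `q` is either registered in the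
frame `U` of `q` (`x − q ∈ U`) or INTERSTITIAL AND STRICTLY ABOVE `q` (`⟪x − q, d⟫ ≤ √3/2` for all
`d ∈ U` and `⟪q, ν⟫ < ⟪x, ν⟫`): such contacts cost nothing in the frame account of `q`.  Conclusion: the
per-ball summand of the frame account (frame `U`, `c = √3/2`) plus its rim summand is `≤ 0`. -/
theorem perBall_frameFilm_le_of_above (X P : Finset (EuclideanSpace ℝ (Fin 3)))
    (hX : ∀ p ∈ X, ∀ q ∈ X, p ≠ q → 1 ≤ dist p q) (hPX : P ⊆ X)
    (U : Finset (EuclideanSpace ℝ (Fin 3))) (hU1 : ∀ d ∈ U, ‖d‖ = 1)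
    (hUsep : ∀ d ∈ U, ∀ d' ∈ U, d ≠ d' → ⟪d, d'⟫_ℝ ≤ 1 / 2)
    (hcap : ∀ ν : EuclideanSpace ℝ (Fin 3), ‖ν‖ = 1 → ∀ t : ℝ, 0 < t →
      ∀ K : Finset (EuclideanSpace ℝ (Fin 3)), K.card ≤ 3 →
      (∀ u ∈ K, ‖u‖ = 1 ∧ ⟪u, ν⟫_ℝ ≤ -t) → (∀ u ∈ K, ∀ u' ∈ K, u ≠ u' → ⟪u, u'⟫_ℝ ≤ 1 / 2) →
      (K.card : ℝ) ≤
        ((U.filter fun d => ⟪d, ν⟫_ℝ < 0 ∧ ((∃ u ∈ K, 1 / 2 < ⟪u, d⟫_ℝ) ∨ ⟪d, ν⟫_ℝ ≤ -t)).card : ℝ)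
          + (1 / 2) * ((U.filter fun d => ⟪d, ν⟫_ℝ = 0 ∧ ∃ u ∈ K, 1 / 2 < ⟪u, d⟫_ℝ).card : ℝ))
    (ν : EuclideanSpace ℝ (Fin 3)) (hν : ‖ν‖ = 1) (R : ℝ)
    (hbelow : ∀ p ∈ P, ⟪p, ν⟫_ℝ ≤ -R) (habove : ∀ x ∈ X \ P, -R < ⟪x, ν⟫_ℝ)
    (q : EuclideanSpace ℝ (Fin 3)) (hq : q ∈ X \ P)
    (h3 : (P.filter fun p => dist q p = 1).card ≤ 3)
    (hreg : ∀ x ∈ X \ P, dist q x = 1 → x - q ∈ U ∨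
      ((∀ d ∈ U, ⟪x - q, d⟫_ℝ ≤ Real.sqrt 3 / 2) ∧ ⟪q, ν⟫_ℝ < ⟪x, ν⟫_ℝ)) :
    (((P.filter fun p => dist q p = 1 ∧ ∀ d ∈ U, ⟪p - q, d⟫_ℝ ≤ Real.sqrt 3 / 2).card : ℝ)
        + (((X \ P).filter fun x => dist q x = 1 ∧ (∀ d ∈ U, ⟪x - q, d⟫_ℝ ≤ Real.sqrt 3 / 2) ∧
            ⟪x, ν⟫_ℝ < ⟪q, ν⟫_ℝ).card : ℝ)
        + (1 / 2) * (((X \ P).filter fun x => dist q x = 1 ∧ (∀ d ∈ U, ⟪x - q, d⟫_ℝ ≤ Real.sqrt 3 / 2) ∧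
            ⟪x, ν⟫_ℝ = ⟪q, ν⟫_ℝ).card : ℝ)
        - ((U.filter fun d => ⟪d, ν⟫_ℝ < 0 ∧
            ∀ x ∈ X, dist q x = 1 → ⟪x - q, d⟫_ℝ ≤ Real.sqrt 3 / 2).card : ℝ)
        - (1 / 2) * ((U.filter fun d => ⟪d, ν⟫_ℝ = 0 ∧
            ∀ x ∈ X, dist q x = 1 → ⟪x - q, d⟫_ℝ ≤ Real.sqrt 3 / 2).card : ℝ))
      + (((U.filter fun d => 0 < ⟪d, ν⟫_ℝ ∧
            ∃ p ∈ P, dist q p = 1 ∧ Real.sqrt 3 / 2 < ⟪p - q, d⟫_ℝ).card : ℝ)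
        + (1 / 2) * ((U.filter fun d => ⟪d, ν⟫_ℝ = 0 ∧
            ∃ p ∈ P, dist q p = 1 ∧ Real.sqrt 3 / 2 < ⟪p - q, d⟫_ℝ).card : ℝ)) ≤ 0 := by
  classical
  obtain ⟨hc0, hc1, -⟩ := sqrt_three_div_two_bounds
  set c : ℝ := Real.sqrt 3 / 2 with hc
  have hhalf_lt_c : (1 : ℝ) / 2 < c := by
    rw [hc, div_lt_div_iff_of_pos_right (by norm_num : (0:ℝ) < 2)]
    have := Real.lt_sqrt (by norm_num : (0:ℝ) ≤ 1) |>.2 (by norm_num : (1:ℝ) ^ 2 < 3)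
    linarith
  have hUsep' : ∀ d ∈ U, ∀ d' ∈ U, d ≠ d' → ⟪d, d'⟫_ℝ ≤ 2 * c ^ 2 - 1 := by
    intro d hd d' hd' hne; rw [hc, two_mul_sqrt_three_div_two_sq_sub_one]; exact hUsep d hd d' hd' hne
  set NP := P.filter fun p => dist q p = 1 with hNP
  set NF := (X \ P).filter fun x => dist q x = 1 with hNF
  set oP : EuclideanSpace ℝ (Fin 3) → Prop := fun d => ∃ p ∈ NP, c < ⟪p - q, d⟫_ℝ with hoP
  set oF : EuclideanSpace ℝ (Fin 3) → Prop := fun d => ∃ x ∈ NF, c < ⟪x - q, d⟫_ℝ with hoF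
  set vc : EuclideanSpace ℝ (Fin 3) → Prop := fun d => ∀ x ∈ X, dist q x = 1 → ⟪x - q, d⟫_ℝ ≤ c with hvc
  set bl : EuclideanSpace ℝ (Fin 3) → Prop := fun d => ∃ p ∈ NP, 1 / 2 < ⟪p - q, d⟫_ℝ with hbl
  set t : ℝ := ⟪q, ν⟫_ℝ + R with ht
  have hqX : q ∈ X := (mem_sdiff.1 hq).1
  have hqP : q ∉ P := (mem_sdiff.1 hq).2
  have ht0 : 0 < t := by have := habove q hq; rw [ht]; linarith
  have hNPX : ∀ p ∈ NP, p ∈ X ∧ dist q p = 1 := fun p hp =>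
    ⟨hPX (mem_filter.1 hp).1, (mem_filter.1 hp).2⟩
  have hNFX : ∀ x ∈ NF, x ∈ X ∧ dist q x = 1 := fun x hx =>
    ⟨(mem_sdiff.1 (mem_filter.1 hx).1).1, (mem_filter.1 hx).2⟩
  -- (0) interstitial film contacts are strictly above `q`
  have hNFint : ∀ x ∈ NF, (∀ d ∈ U, ⟪x - q, d⟫_ℝ ≤ c) → ⟪q, ν⟫_ℝ < ⟪x, ν⟫_ℝ := by
    intro x hx h
    rcases hreg x (mem_filter.1 hx).1 (mem_filter.1 hx).2 with hxq | ⟨-, habv⟩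
    · have := h (x - q) hxq
      rw [real_inner_self_eq_norm_sq, ← dist_eq_norm, dist_comm, (mem_filter.1 hx).2, one_pow] at this
      linarith
    · exact habv
  have hF1 : (((X \ P).filter fun x => dist q x = 1 ∧ (∀ d ∈ U, ⟪x - q, d⟫_ℝ ≤ c) ∧
      ⟪x, ν⟫_ℝ < ⟪q, ν⟫_ℝ).card : ℝ) = 0 := by
    rw [Nat.cast_eq_zero, card_eq_zero, filter_eq_empty_iff]
    rintro x hx ⟨hqx, hint, hlt⟩
    exact absurd (hNFint x (mem_filter.2 ⟨hx, hqx⟩) hint) (not_lt.2 hlt.le)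
  have hF2 : (((X \ P).filter fun x => dist q x = 1 ∧ (∀ d ∈ U, ⟪x - q, d⟫_ℝ ≤ c) ∧
      ⟪x, ν⟫_ℝ = ⟪q, ν⟫_ℝ).card : ℝ) = 0 := by
    rw [Nat.cast_eq_zero, card_eq_zero, filter_eq_empty_iff]
    rintro x hx ⟨hqx, hint, heq⟩
    exact absurd (hNFint x (mem_filter.2 ⟨hx, hqx⟩) hint) (by rw [heq]; exact lt_irrefl _)
  -- (1) occupancy states are exclusive; vacancy is the complement
  have hexcl : ∀ d ∈ U, ¬ (oP d ∧ oF d) := by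
    rintro d hd ⟨⟨p, hp, hpd⟩, ⟨x, hx, hxd⟩⟩
    have := capPartner_unique X hX (hNPX p hp).1 (hNFX x hx).1 (hNPX p hp).2 (hNFX x hx).2 (hU1 d hd)
      hpd hxd
    exact (mem_sdiff.1 (mem_filter.1 hx).1).2 (this ▸ (mem_filter.1 hp).1)
  have hvc_iff : ∀ d ∈ U, vc d ↔ ¬ (oP d ∨ oF d) := by
    intro d hd
    constructor
    · rintro h (⟨p, hp, hpd⟩ | ⟨x, hx, hxd⟩)
      · exact absurd (h p (hNPX p hp).1 (hNPX p hp).2) (not_le.2 hpd)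
      · exact absurd (h x (hNFX x hx).1 (hNFX x hx).2) (not_le.2 hxd)
    · intro h x hxX hqx
      by_contra hle
      have hlt : c < ⟪x - q, d⟫_ℝ := lt_of_not_ge hle
      by_cases hxP : x ∈ P
      · exact h (Or.inl ⟨x, mem_filter.2 ⟨hxP, hqx⟩, hlt⟩)
      · exact h (Or.inr ⟨x, mem_filter.2 ⟨mem_sdiff.2 ⟨hxX, hxP⟩, hqx⟩, hlt⟩)
  have hsplit : ∀ S : Finset (EuclideanSpace ℝ (Fin 3)), S ⊆ U →
      (S.card : ℝ) = (S.filter oP).card + (S.filter oF).card + (S.filter vc).card := by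
    intro S hS
    have h1 := card_filter_add_card_filter_not (s := S) (fun d => oP d ∨ oF d)
    have h2 : (S.filter fun d => oP d ∨ oF d).card = (S.filter oP).card + (S.filter oF).card := by
      rw [filter_or, card_union_of_disjoint]
      exact disjoint_filter.2 fun d hd h1 h2 => hexcl d (hS hd) ⟨h1, h2⟩
    have h3 : (S.filter fun d => ¬ (oP d ∨ oF d)) = S.filter vc :=
      filter_congr fun d hd => (hvc_iff d (hS hd)).symm
    rw [h2, h3] at h1
    exact_mod_cast h1.symm
  -- (2) registered substrate contacts ↔ caps occupied by the substrate
  have hregP : ((NP.filter fun p => ∃ d ∈ U, c < ⟪p - q, d⟫_ℝ).card : ℝ) = (U.filter oP).card := by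
    have := card_filter_exists_comm NP U (fun p d => c < ⟪p - q, d⟫_ℝ)
      (fun p hp d hd d' hd' h1 h2 => frameDir_unique c le_rfl (hNPX p hp).2 (hU1 d hd) (hU1 d' hd')
        (fun hne => hUsep' d hd d' hd' hne) h1 h2)
      (fun d hd p hp p' hp' h1 h2 => capPartner_unique X hX (hNPX p hp).1 (hNPX p' hp').1 (hNPX p hp).2
        (hNPX p' hp').2 (hU1 d hd) h1 h2)
    exact_mod_cast this
  have hsplitP : (NP.card : ℝ) = (NP.filter fun p => ∃ d ∈ U, c < ⟪p - q, d⟫_ℝ).card +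
      (NP.filter fun p => ∀ d ∈ U, ⟪p - q, d⟫_ℝ ≤ c).card := by
    have h := card_filter_add_card_filter_not (s := NP) (fun p => ∃ d ∈ U, c < ⟪p - q, d⟫_ℝ)
    have e : (NP.filter fun p => ¬ ∃ d ∈ U, c < ⟪p - q, d⟫_ℝ) = NP.filter fun p => ∀ d ∈ U, ⟪p - q, d⟫_ℝ ≤ c := by
      refine filter_congr fun p _ => ?_
      simp only [not_exists, not_and, not_lt]
    rw [e] at h; exact_mod_cast h.symm
  -- sign classes of `U`
  set Dn := U.filter fun d => ⟪d, ν⟫_ℝ < 0 with hDn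
  set Up := U.filter fun d => 0 < ⟪d, ν⟫_ℝ with hUp
  set Lv := U.filter fun d => ⟪d, ν⟫_ℝ = 0 with hLv
  have hDnU : Dn ⊆ U := filter_subset _ _
  have hLvU : Lv ⊆ U := filter_subset _ _
  have hUsplit : ∀ (Rr : EuclideanSpace ℝ (Fin 3) → Prop) [DecidablePred Rr],
      ((U.filter Rr).card : ℝ) = (Dn.filter Rr).card + (Up.filter Rr).card + (Lv.filter Rr).card := by
    intro Rr _
    have h1 := card_filter_add_card_filter_not (s := U.filter Rr) (fun d => ⟪d, ν⟫_ℝ < 0)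
    have h2 := card_filter_add_card_filter_not (s := (U.filter Rr).filter fun d => ¬ ⟪d, ν⟫_ℝ < 0)
      (fun d => 0 < ⟪d, ν⟫_ℝ)
    have e1 : (U.filter Rr).filter (fun d => ⟪d, ν⟫_ℝ < 0) = Dn.filter Rr := by
      ext d; simp only [hDn, mem_filter]
      constructor
      · rintro ⟨⟨h1, h2⟩, h3⟩; exact ⟨⟨h1, h3⟩, h2⟩
      · rintro ⟨⟨h1, h3⟩, h2⟩; exact ⟨⟨h1, h2⟩, h3⟩
    have e2 : ((U.filter Rr).filter fun d => ¬ ⟪d, ν⟫_ℝ < 0).filter (fun d => 0 < ⟪d, ν⟫_ℝ) = Up.filter Rr := by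
      ext d; simp only [hUp, mem_filter]
      constructor
      · rintro ⟨⟨⟨h1, h2⟩, _⟩, h4⟩; exact ⟨⟨h1, h4⟩, h2⟩
      · rintro ⟨⟨h1, h4⟩, h2⟩; exact ⟨⟨⟨h1, h2⟩, not_lt.2 h4.le⟩, h4⟩
    have e3 : ((U.filter Rr).filter fun d => ¬ ⟪d, ν⟫_ℝ < 0).filter (fun d => ¬ 0 < ⟪d, ν⟫_ℝ) = Lv.filter Rr := by
      ext d; simp only [hLv, mem_filter]
      constructor
      · rintro ⟨⟨⟨h1, h2⟩, h3⟩, h4⟩; exact ⟨⟨h1, le_antisymm (not_lt.1 h4) (not_lt.1 h3)⟩, h2⟩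
      · rintro ⟨⟨h1, h4⟩, h2⟩; exact ⟨⟨⟨h1, h2⟩, by rw [h4]; exact lt_irrefl 0⟩, by rw [h4]; exact lt_irrefl 0⟩
    rw [e1] at h1; rw [e2, e3] at h2
    have h1' : ((U.filter Rr).card : ℝ) = (Dn.filter Rr).card + (((U.filter Rr).filter fun d => ¬ ⟪d, ν⟫_ℝ < 0).card : ℝ) := by
      exact_mod_cast h1.symm
    have h2' : ((((U.filter Rr).filter fun d => ¬ ⟪d, ν⟫_ℝ < 0).card : ℕ) : ℝ) = (Up.filter Rr).card + (Lv.filter Rr).card := by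
      exact_mod_cast h2.symm
    rw [h1', h2']; ring
  -- (3) a film-occupied cap `d` is exactly the slot `q + d`, which is neither steep nor blocked
  have hoF_slot : ∀ d ∈ U, oF d → q + d ∈ X \ P := by
    rintro d hd ⟨x, hx, hxd⟩
    have hxq : x - q ∈ U := by
      rcases hreg x (mem_filter.1 hx).1 (mem_filter.1 hx).2 with h | ⟨hint, -⟩
      · exact h
      · exact absurd (hint d hd) (not_le.2 hxd)
    have := eq_add_of_registered hUsep hxq hd hxd
    rw [← this]; exact (mem_filter.1 hx).1
  have hoF_not_steep : ∀ d ∈ U, oF d → ¬ ⟪d, ν⟫_ℝ ≤ -t := by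
    intro d hd hoFd hst
    have hslot := hoF_slot d hd hoFd
    have h1 := habove (q + d) hslot
    rw [inner_add_left] at h1
    rw [ht] at hst
    linarith
  have hoF_not_bl : ∀ d ∈ U, oF d → ¬ bl d := by
    rintro d hd hoFd ⟨p, hp, hpd⟩
    have hslot := hoF_slot d hd hoFd
    have hpP : p ∈ P := (mem_filter.1 hp).1
    have hne : p ≠ q + d := fun h => (mem_sdiff.1 hslot).2 (h ▸ hpP)
    have h1 := hX p (hPX hpP) (q + d) (mem_sdiff.1 hslot).1 hne
    have hu : ‖p - q‖ = 1 := by rw [← dist_eq_norm, dist_comm, (hNPX p hp).2]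
    have hsq : dist p (q + d) ^ 2 < 1 := by
      rw [dist_eq_norm, show p - (q + d) = (p - q) - d by abel, norm_sub_sq_real, hu, hU1 d hd]
      linarith
    nlinarith [dist_nonneg (x := p) (y := q + d)]
  -- (4) the cap budget applied to the substrate contacts of `q`
  set K := NP.image fun p => p - q with hK
  have hKcard : K.card = NP.card := card_image_of_injective _ sub_left_injective
  have hKmem : ∀ u ∈ K, ∃ p ∈ NP, p - q = u := fun u hu => by
    simpa only [hK, mem_image] using hu
  have hK1 : ∀ u ∈ K, ‖u‖ = 1 ∧ ⟪u, ν⟫_ℝ ≤ -t := by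
    intro u hu
    obtain ⟨p, hp, rfl⟩ := hKmem u hu
    refine ⟨by rw [← dist_eq_norm, dist_comm, (hNPX p hp).2], ?_⟩
    rw [inner_sub_left, ht]
    have := hbelow p (mem_filter.1 hp).1
    linarith
  have hK2 : ∀ u ∈ K, ∀ u' ∈ K, u ≠ u' → ⟪u, u'⟫_ℝ ≤ 1 / 2 := by
    intro u hu u' hu' hne
    obtain ⟨p, hp, rfl⟩ := hKmem u hu
    obtain ⟨p', hp', rfl⟩ := hKmem u' hu'
    have hpp' : p ≠ p' := fun h => hne (by rw [h])
    exact real_inner_sub_le_half_of_dist (hNPX p hp).2 (hNPX p' hp').2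
      (hX p (hNPX p hp).1 p' (hNPX p' hp').1 hpp')
  have hK3 : K.card ≤ 3 := by rw [hKcard]; exact h3
  have hbudget := hcap ν hν t ht0 K hK3 hK1 hK2
  have hblK : ∀ d, (∃ u ∈ K, 1 / 2 < ⟪u, d⟫_ℝ) ↔ bl d := by
    intro d
    constructor
    · rintro ⟨u, hu, hud⟩
      obtain ⟨p, hp, rfl⟩ := hKmem u hu
      exact ⟨p, hp, hud⟩
    · rintro ⟨p, hp, hpd⟩
      exact ⟨p - q, mem_image.2 ⟨p, hp, rfl⟩, hpd⟩
  have hB1 : (U.filter fun d => ⟪d, ν⟫_ℝ < 0 ∧ ((∃ u ∈ K, 1 / 2 < ⟪u, d⟫_ℝ) ∨ ⟪d, ν⟫_ℝ ≤ -t)) =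
      Dn.filter fun d => bl d ∨ ⟪d, ν⟫_ℝ ≤ -t := by
    rw [hDn, filter_filter]
    exact filter_congr fun d _ => and_congr Iff.rfl (or_congr (hblK d) Iff.rfl)
  have hB2 : (U.filter fun d => ⟪d, ν⟫_ℝ = 0 ∧ ∃ u ∈ K, 1 / 2 < ⟪u, d⟫_ℝ) = Lv.filter bl := by
    rw [hLv, filter_filter]
    exact filter_congr fun d _ => and_congr Iff.rfl (hblK d)
  rw [hB1, hB2, hKcard] at hbudget
  -- (5) the film-occupied down / level caps miss the steep-or-blocked / blocked ones
  have hoF_Dn : ((Dn.filter oF).card : ℝ) + (Dn.filter fun d => bl d ∨ ⟪d, ν⟫_ℝ ≤ -t).card ≤ Dn.card := by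
    have h := card_union_of_disjoint (disjoint_filter.2 fun d hd (h1 : oF d) (h2 : bl d ∨ ⟪d, ν⟫_ℝ ≤ -t) =>
      h2.elim (hoF_not_bl d (hDnU hd) h1) (hoF_not_steep d (hDnU hd) h1))
    have h' := card_le_card (union_subset (filter_subset oF Dn)
      (filter_subset (fun d => bl d ∨ ⟪d, ν⟫_ℝ ≤ -t) Dn))
    rw [h] at h'
    exact_mod_cast h'
  have hoF_Lv : ((Lv.filter oF).card : ℝ) + (Lv.filter bl).card ≤ Lv.card := by
    have h := card_union_of_disjoint (disjoint_filter.2 fun d hd (h1 : oF d) (h2 : bl d) =>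
      hoF_not_bl d (hLvU hd) h1 h2)
    have h' := card_le_card (union_subset (filter_subset oF Lv) (filter_subset bl Lv))
    rw [h] at h'
    exact_mod_cast h'
  -- (6) rewrite the statement's filters
  have r1 : (P.filter fun p => dist q p = 1 ∧ ∀ d ∈ U, ⟪p - q, d⟫_ℝ ≤ c) =
      NP.filter fun p => ∀ d ∈ U, ⟪p - q, d⟫_ℝ ≤ c := by rw [hNP, filter_filter]
  have hvD : (U.filter fun d => ⟪d, ν⟫_ℝ < 0 ∧ ∀ x ∈ X, dist q x = 1 → ⟪x - q, d⟫_ℝ ≤ c) = Dn.filter vc := by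
    rw [hDn, filter_filter]
  have hvL : (U.filter fun d => ⟪d, ν⟫_ℝ = 0 ∧ ∀ x ∈ X, dist q x = 1 → ⟪x - q, d⟫_ℝ ≤ c) = Lv.filter vc := by
    rw [hLv, filter_filter]
  have r5 : (U.filter fun d => 0 < ⟪d, ν⟫_ℝ ∧ ∃ p ∈ P, dist q p = 1 ∧ c < ⟪p - q, d⟫_ℝ) = Up.filter oP := by
    rw [hUp, filter_filter]
    refine filter_congr fun d _ => and_congr Iff.rfl ?_
    simp only [hoP, hNP, mem_filter, and_assoc]
  have r6 : (U.filter fun d => ⟪d, ν⟫_ℝ = 0 ∧ ∃ p ∈ P, dist q p = 1 ∧ c < ⟪p - q, d⟫_ℝ) = Lv.filter oP := by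
    rw [hLv, filter_filter]
    refine filter_congr fun d _ => and_congr Iff.rfl ?_
    simp only [hoP, hNP, mem_filter, and_assoc]
  rw [r1, hF1, hF2, hvD, hvL, r5, r6]
  have sDn := hsplit Dn hDnU
  have sLv := hsplit Lv hLvU
  have pP := hUsplit oP
  rw [hregP] at hsplitP
  have hnn : (0 : ℝ) ≤ ((Lv.filter oP).card : ℝ) := Nat.cast_nonneg _
  have hnn2 : (0 : ℝ) ≤ ((Dn.filter oP).card : ℝ) := Nat.cast_nonneg _
  linarith [sDn, sLv, pP, hsplitP, hbudget, hoF_Dn, hoF_Lv]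

end Summit.Ventures.Crystal3D.Theorems

end
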